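import Summits.Ventures.Crystal3D.Theorems.StickyWulffConstantTextureLiminfTexShadowFaultedSameFrame
import Summits.Ventures.Crystal3D.Theorems.StickyWulffConstantTextureLiminfTexShadowFLayerDefs
import Summits.Ventures.Crystal3D.Theorems.StickyWulffConstantTextureLiminfTexShadowBothFccDefs
import Summits.Ventures.Crystal3D.Theorems.StickyWulffConstantCoaxialWallLawTwoLatticeAdm
import Summits.Ventures.Crystal3D.Theorems.StickyWulffConstantGenericWallFloorMixedDozenRules
import HarnessLib

/-!
# The ONE-FCC F_layer cell: FRAME DICTIONARY between lane T's bilayer frames and the word net's base frame (file (C2) of the plan)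

HONEST FRAMING. Venture `Summits/Ventures/Crystal3D` (cell `crystal3d-full`); helper `--supports` the law-v5 crux `TextureLiminfV5`
(stmt-Ventures-23912), registered stub `stub_fLayerOneFcc` (TexShadow v8.4; owner 19481-p1, cf-p1 (civ)/(cx);
HOME/wall-19481-p1/g15/ONEFCC-ASSEMBLY-PLAN-g15.md).  Pure bookkeeping, standard axioms; nothing about the stub is claimed; F-C1 not moved.

The OneFcc export `wordNet_barlow_endPairs_oneFcc` (p698172) is parametrised by a base frame `Fr ∈ {L₁, basalMirror ≫ L₁}` (sign `t`),
the fcc plate's reading frame `Gf ∈ {L₂, basalMirror ≫ L₂}` (sign `ε`, the constant value of `σ₂`), the dozen identity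
`Gf '' D₊ = Fr '' (basalMirror '' D₊)` and the admissible layers `¬(σ₁(k−1) = −t ∧ σ₁ k = −t)`; the charge side (p698732) is phrased with
the bilayer lattices `A₁ i '' Λ₀`, `A₂ j '' Λ₀ = D`.  This file translates:
* `bilayerFrame_image_eq_of_sign` — under `BilayerFramesAt L s σ A u`: `σ i = 1 ⇒ A i '' Λ₀ = L '' Λ₀`, `σ i = −1 ⇒ A i '' Λ₀ = (bM ≫ L) '' Λ₀`
  (T's `bilayer_subset_stacking_const` + `image_fccRef_eq_of_bilayer_subset`);
* `image_fccSlots_eq_of_image_fccRef_eq` (equal linear lattices ⇒ equal slot dozens), `image_fccSlots_ne_basalTwin`,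
  `image_fccRef_ne_basalTwin` (a lattice is never its own basal twin; 19481-p2's `PlateSystem.image_ne_basalMirror`);
* **`oneFcc_frame_dictionary`** — for a faulted plate 1 (both signs occur) and a sign-constant plate 2 (`σ₂ ≡ ε`) in ONE twin family:
  with `Gf := L₂` (`ε = 1`) / `basalMirror ≫ L₂` (`ε = −1`) and `D := Gf '' Λ₀`, every `A₂ j '' Λ₀ = D`, and there are `Fr, t` with
  `(t = 1 ∧ Fr = L₁) ∨ (t = −1 ∧ Fr = bM ≫ L₁)`, `Gf '' D₊ = Fr '' (bM '' D₊)`, and `A₁ i '' Λ₀ ≠ D ↔ σ₁ i = t` for every `i`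
  (so the charged strips of p698732 are exactly `{i : σ₁ i = t}` and every charged strip's upper layer `i+1` is admissible).
WHAT THIS IS NOT: not the flux, not the assembly; F-C1 not moved.
-/

noncomputable section

open scoped BigOperators InnerProductSpace ENNReal

namespace Summit.Ventures.Crystal3D.Theorems

open Summit.Ventures.Crystal3D
open Literature.MathematicalPhysics.StatisticalMechanics (IsHaggSeq basalMirror basalMirror_basalMirror fccStacking constHagg
  haggLabel barlowOffset)
open Summit.Ventures.Crystal3D.TentCertificate (image_fccRef_eq_of_bilayer_subset)
open Summit.Ventures.Crystal3D.Cruxes.TextureLiminf.TexShadow (E3 e₃ fccRef stacking bilayer BilayerFramesAt InTwinFamily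
  stacking_constHagg stacking_const_neg const_one_eq_constHagg)

/-- **The bilayer lattice by the sign of the Hägg letter.** -/
theorem bilayerFrame_image_eq_of_sign {σ : ℤ → ℤ} (hσ : IsHaggSeq σ) (L : E3 ≃ₗᵢ[ℝ] E3) (s : E3)
    {A : ℤ → (E3 ≃ₗᵢ[ℝ] E3)} {u : ℤ → E3} (hfr : BilayerFramesAt L s σ A u) (i : ℤ) :
    (σ i = 1 → A i '' fccRef = L '' fccRef) ∧ (σ i = -1 → A i '' fccRef = (basalMirror.trans L) '' fccRef) := by
  have hsub := bilayer_subset_stacking_const L s σ i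
  constructor
  · intro h1
    have hc : (fun _ : ℤ => σ i) = constHagg := by funext; rw [h1]; rfl
    rw [hc, stacking_constHagg] at hsub
    exact image_fccRef_eq_of_bilayer_subset hσ L s i (hfr i) hsub
  · intro h1
    have hc : (fun _ : ℤ => σ i) = (fun _ : ℤ => (-1 : ℤ)) := by funext; rw [h1]
    rw [hc, stacking_const_neg] at hsub
    exact image_fccRef_eq_of_bilayer_subset hσ L s i (hfr i) hsub

/-- Equal linear lattices have equal slot dozens. -/
theorem image_fccSlots_eq_of_image_fccRef_eq {A B : E3 ≃ₗᵢ[ℝ] E3} (h : A '' fccRef = B '' fccRef) :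
    (A : E3 → E3) '' ↑fccSlots = (B : E3 → E3) '' ↑fccSlots := by
  have key : ∀ {A B : E3 ≃ₗᵢ[ℝ] E3}, A '' fccRef = B '' fccRef → (A : E3 → E3) '' ↑fccSlots ⊆ (B : E3 → E3) '' ↑fccSlots := by
    intro A B h x hx
    obtain ⟨w, hw, rfl⟩ := hx
    have hwΛ : A w ∈ A '' fccRef := ⟨w, mem_fcc_of_mem_fccSlots (Finset.mem_coe.1 hw), rfl⟩
    rw [h] at hwΛ
    obtain ⟨v, hv, hv'⟩ := hwΛ
    have hvn : ‖v‖ = 1 := by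
      rw [← B.norm_map v, hv', A.norm_map, norm_eq_one_of_mem_fccSlots (Finset.mem_coe.1 hw)]
    exact ⟨v, Finset.mem_coe.2 (mem_fccSlots_of_unit hv hvn), hv'⟩
  exact Set.Subset.antisymm (key h) (key h.symm)

/-- A slot dozen is never its own basal twin. -/
theorem image_fccSlots_ne_basalTwin (L : E3 ≃ₗᵢ[ℝ] E3) :
    (L : E3 → E3) '' ↑fccSlots ≠ ((basalMirror.trans L : E3 ≃ₗᵢ[ℝ] E3) : E3 → E3) '' ↑fccSlots := by
  intro h
  have hmodel := PlateSystem.image_ne_basalMirror ⟨LinearIsometryEquiv.refl ℝ E3, ∅⟩ (r := 0) rfl (κ := []) trivial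
  have h' : (L : E3 → E3) '' ↑fccSlots = (L : E3 → E3) '' ((basalMirror : E3 → E3) '' ↑fccSlots) := by
    rw [h, Set.image_image]; rfl
  have h'' := (Set.image_injective.2 L.injective) h'
  have e1 : ((LinearIsometryEquiv.refl ℝ E3 : E3 ≃ₗᵢ[ℝ] E3) : E3 → E3) '' ↑fccSlots = ↑fccSlots := by simp
  have e2 : ((basalMirror.trans (LinearIsometryEquiv.refl ℝ E3) : E3 ≃ₗᵢ[ℝ] E3) : E3 → E3) '' ↑fccSlots =
      (basalMirror : E3 → E3) '' ↑fccSlots := by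
    ext y; simp
  apply hmodel
  show ((LinearIsometryEquiv.refl ℝ E3 : E3 ≃ₗᵢ[ℝ] E3) : E3 → E3) '' ↑fccSlots =
    ((basalMirror.trans (LinearIsometryEquiv.refl ℝ E3) : E3 ≃ₗᵢ[ℝ] E3) : E3 → E3) '' ↑fccSlots
  rw [e1, e2]; exact h''

/-- A linear lattice is never its own basal twin. -/
theorem image_fccRef_ne_basalTwin (L : E3 ≃ₗᵢ[ℝ] E3) : L '' fccRef ≠ (basalMirror.trans L) '' fccRef :=
  fun h => image_fccSlots_ne_basalTwin L (image_fccSlots_eq_of_image_fccRef_eq h)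

/-- **THE ONE-FCC FRAME DICTIONARY.**  See the module docstring. -/
theorem oneFcc_frame_dictionary {σ₁ σ₂ : ℤ → ℤ} (hσ₁ : IsHaggSeq σ₁) (hσ₂ : IsHaggSeq σ₂)
    (hnc : ¬ (∀ k : ℤ, σ₁ k = σ₁ 0)) {ε : ℤ} (hε : ε = 1 ∨ ε = -1) (hσ₂c : ∀ n : ℤ, σ₂ n = ε)
    (L₁ L₂ P : E3 ≃ₗᵢ[ℝ] E3) (s₁ s₂ : E3) {A₁ A₂ : ℤ → (E3 ≃ₗᵢ[ℝ] E3)} {u₁ u₂ : ℤ → E3}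
    (hfr₁ : BilayerFramesAt L₁ s₁ σ₁ A₁ u₁) (hfr₂ : BilayerFramesAt L₂ s₂ σ₂ A₂ u₂)
    (hf₁ : InTwinFamily P A₁) (hf₂ : InTwinFamily P A₂) :
    ∃ (Gf Fr : E3 ≃ₗᵢ[ℝ] E3) (t : ℤ), ((ε = 1 ∧ Gf = L₂) ∨ (ε = -1 ∧ Gf = basalMirror.trans L₂)) ∧
      ((t = 1 ∧ Fr = L₁) ∨ (t = -1 ∧ Fr = basalMirror.trans L₁)) ∧
      (∀ j, A₂ j '' fccRef = Gf '' fccRef) ∧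
      (Gf : E3 → E3) '' ↑fccSlots = (fun x => Fr (basalMirror x)) '' ↑fccSlots ∧
      (∀ i, A₁ i '' fccRef ≠ Gf '' fccRef ↔ σ₁ i = t) := by
  -- the fcc plate's reading frame and lattice
  obtain ⟨Gf, hGf, hD⟩ : ∃ Gf : E3 ≃ₗᵢ[ℝ] E3, ((ε = 1 ∧ Gf = L₂) ∨ (ε = -1 ∧ Gf = basalMirror.trans L₂)) ∧
      ∀ j, A₂ j '' fccRef = Gf '' fccRef := by
    rcases hε with rfl | rfl
    · exact ⟨L₂, Or.inl ⟨rfl, rfl⟩, fun j => (bilayerFrame_image_eq_of_sign hσ₂ L₂ s₂ hfr₂ j).1 (hσ₂c j)⟩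
    · exact ⟨basalMirror.trans L₂, Or.inr ⟨rfl, rfl⟩, fun j => (bilayerFrame_image_eq_of_sign hσ₂ L₂ s₂ hfr₂ j).2 (hσ₂c j)⟩
  -- both signs occur in plate 1
  obtain ⟨ip, im, hip, him⟩ : ∃ ip im : ℤ, σ₁ ip = 1 ∧ σ₁ im = -1 := by
    by_contra hno
    push Not at hno
    apply hnc
    intro k
    rcases hσ₁ k with hk | hk <;> rcases hσ₁ 0 with h0 | h0
    · rw [hk, h0]
    · exact absurd h0 (hno k 0 hk)
    · exact absurd hk (hno 0 k h0)
    · rw [hk, h0]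
  have hL₁ : A₁ ip '' fccRef = L₁ '' fccRef := (bilayerFrame_image_eq_of_sign hσ₁ L₁ s₁ hfr₁ ip).1 hip
  have hM₁ : A₁ im '' fccRef = (basalMirror.trans L₁) '' fccRef := (bilayerFrame_image_eq_of_sign hσ₁ L₁ s₁ hfr₁ im).2 him
  have hne₁ := image_fccRef_ne_basalTwin L₁
  -- the twin family of `P` is `{L₁ '' Λ₀, (bM ≫ L₁) '' Λ₀}`
  have hfam : ∀ E : Set E3, (E = P '' fccRef ∨ E = (basalMirror.trans P) '' fccRef) →
      E = L₁ '' fccRef ∨ E = (basalMirror.trans L₁) '' fccRef := by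
    have hp' := hf₁ ip
    have hm' := hf₁ im
    rw [hL₁] at hp'
    rw [hM₁] at hm'
    intro E hE
    rcases hE with rfl | rfl <;> rcases hp' with hp' | hp' <;> rcases hm' with hm' | hm'
    · exact Or.inl hp'.symm
    · exact Or.inl hp'.symm
    · exact Or.inr hm'.symm
    · exact absurd (hp'.trans hm'.symm) hne₁
    · exact absurd (hp'.trans hm'.symm) hne₁
    · exact Or.inr hm'.symm
    · exact Or.inl hp'.symm
    · exact Or.inl hp'.symm
  have hDfam : Gf '' fccRef = L₁ '' fccRef ∨ Gf '' fccRef = (basalMirror.trans L₁) '' fccRef := by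
    have := hf₂ 0
    rw [hD 0] at this
    exact hfam _ this
  -- the dictionary for every `i`
  have hAi : ∀ i, (σ₁ i = 1 ∧ A₁ i '' fccRef = L₁ '' fccRef) ∨ (σ₁ i = -1 ∧ A₁ i '' fccRef = (basalMirror.trans L₁) '' fccRef) := by
    intro i
    rcases hσ₁ i with h | h
    · exact Or.inl ⟨h, (bilayerFrame_image_eq_of_sign hσ₁ L₁ s₁ hfr₁ i).1 h⟩
    · exact Or.inr ⟨h, (bilayerFrame_image_eq_of_sign hσ₁ L₁ s₁ hfr₁ i).2 h⟩
  rcases hDfam with hDL | hDM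
  · -- `D = L₁ '' Λ₀`: the tree is the mirror frame (`t = −1`)
    refine ⟨Gf, basalMirror.trans L₁, -1, hGf, Or.inr ⟨rfl, rfl⟩, hD, ?_, fun i => ?_⟩
    · rw [image_fccSlots_eq_of_image_fccRef_eq hDL]
      refine Set.image_congr fun x _ => ?_
      rw [LinearIsometryEquiv.trans_apply, basalMirror_basalMirror]
    · rcases hAi i with ⟨hs, hA⟩ | ⟨hs, hA⟩
      · rw [hA, hDL, hs]; simp
      · rw [hA, hDL, hs]; simp only [iff_true]; exact hne₁.symm
  · -- `D = (bM ≫ L₁) '' Λ₀`: the tree is the plate frame (`t = 1`)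
    refine ⟨Gf, L₁, 1, hGf, Or.inl ⟨rfl, rfl⟩, hD, ?_, fun i => ?_⟩
    · rw [image_fccSlots_eq_of_image_fccRef_eq hDM]
      refine Set.image_congr fun x _ => ?_
      rw [LinearIsometryEquiv.trans_apply]
    · rcases hAi i with ⟨hs, hA⟩ | ⟨hs, hA⟩
      · rw [hA, hDM, hs]; simp only [iff_true]; exact hne₁
      · rw [hA, hDM, hs]; simp

end Summit.Ventures.Crystal3D.Theorems

end
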